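import Summits.PneNP.PneNP.Theorems.PairwiseSALinear
import Summits.PneNP.PneNP.Theorems.IP3ExpandingExist
import Summits.PneNP.PneNP.Theorems.IP3DensityExist
import Summits.PneNP.PneNP.Theorems.SASubThreshold

/-!
# HEADLINE-23-A: density-uniform Sherali–Adams blindness for pure `IP₃` below the `n^{3/2}` threshold (cell `pnp-ideate`, ROUND-23)

FRONTIER range-avoidance ladder, rung F-N3 context (restricted-model lower bound for the Sherali–Adams hierarchy) — nothing here
bears on `P` vs `NP`.

`ip3SASubThresholdBlind : SASubThreshold.IP3SASubThresholdBlind`, assembled BY NAME from the three suppliers of p3's wiring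
`SASubThreshold.ip3SASubThresholdBlind_of`: the biased-BGMT hub `PairwiseSA.pairwiseSALinearLevel` (prover-2, T22.0), the `IP₃`
fibre laws `IP3ExpandingExist.ip3PairwiseLaws'` (prover-1, T22.1a(i)) and the density-uniform existence of
`(r, (3t+1)/t)`-boundary expanding pure-`IP₃` instances `IP3DensityExist.ip3ExpandingDensity` (prover-2, T23.1-A).  Reading: for
every `t ≥ 2` there is `c > 0` such that for every density `Δ ≥ 2` and infinitely many `n` some pure-`IP₃` `6`-local map with `Δ·n`
outputs has a point outside its range while level-`r` Sherali–Adams is feasible for EVERY target whenever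
`c·Δ^{2t}·r^{t−1} ≤ n^{t−1}` — a polynomial blind level at every stretch `m = n^{3/2−ε}` (SA only; honest scope per `SASubThreshold`).
-/

set_option linter.dupNamespace false

namespace Summit.PneNP.PneNP.Theorems.SASubThreshold

/-- **HEADLINE-23-A (ROUND-23).**  Density-uniform sub-threshold Sherali–Adams blindness for pure-`IP₃` range avoidance.
Restricted-model lower bound for a relaxation hierarchy; it says nothing about `P` versus `NP`. -/
theorem ip3SASubThresholdBlind : IP3SASubThresholdBlind :=
  ip3SASubThresholdBlind_of PairwiseSA.pairwiseSALinearLevel IP3ExpandingExist.ip3PairwiseLaws'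
    IP3DensityExist.ip3ExpandingDensity

end Summit.PneNP.PneNP.Theorems.SASubThreshold
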